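import Summits.BirchSwinnertonDyer.BirchSwinnertonDyer.Theorems.ManinLocalTwoThreeSixteenDescendsNegOne
import Summits.BirchSwinnertonDyer.BirchSwinnertonDyer.Theorems.ManinLocalTwoThreeQuadraticTwistAtTwoConductorBarriosRows
import HarnessLib

/-!
# S-an-63 `SixteenExactDescends` and S-an-63L `conductorExponent_quadraticTwist_two_of_eq_four` ARE THEOREMS (an g32 §11 def bodies VERBATIM):
# `f₂(W) = 4 ⟹ f₂(W ⊗ d) ≤ 3` for every `d ≡ 3 (mod 4)`, and `16 ∥ N(W) ⟹ 16 ∤ N(W ⊗ χ₋₄)` (route `ManinLocalTwoThree`, crux C2 `ManinOddAtFour`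
# stmt-BirchSwinnertonDyer-22967; cell bsd-f2-manin, p2 gen 14 — the `d ≡ 3 (4)` transport and the by-name bodies over the d = −1 assembly of p3 gen 12)

Barrios–Roy–Sahajpal–Tallana–Tobin–Wiersema 2025, Thm. 5.1, Table localdata-dodd, `d ≡ 3 (mod 4)`: no row with `f = 4` keeps `f^d = 4`
(`II → III/IV`, `I₀* → I₁*/IV*`, `I₂* → III*`, `I₃* → II*`, `I₄* → I₀`, `II* → I₀`, `Iₙ≥5* → I_{n−4}`).  The seven rows were kernel-checked for
`d = −1` by this cell's prover seats (p3 g12: `…NegOneTwistTypeTwoFour`, `…NegOneTwistIstarZeroEight`, `…NegOneTwistIstarTwoTen`, `…NegOneTwistIstarDeep`,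
`…NegOneTwistIstarThreeIIstar`; p2 g14: `…SixteenDescendsOrdJ`, `…IstarDeepAtTwoOrdJ`, `…SixteenDescendsIstarTwoThree`) and assembled over p3's type list `kodairaSymbolAt_of_conductorExponent_eq_four_two` as `conductorExponent_quadraticTwist_negOne_le_three_of_eq_four`
(`…SixteenDescendsNegOne`, p3 g12).  This file:
* §1 the reduction to `d = −1` (this seat's g13 kit `conductorExponent_quadraticTwist_of_emod_four_eq_three_two`: `W ⊗ d = (W ⊗ (−d)) ⊗ (−1)` on
  the nose and `f₂(W ⊗ (−d)) = f₂(W)` for `−d ≡ 1 (mod 4)`), giving an's S-an-63L body verbatim;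
* §2 the conductor-norm form, an's S-an-63 `SixteenExactDescends` body verbatim (`(N(W)).factorization 2 = f₂(W)`);
* §3 the `χ_d`-ORBIT LAW at `16 ∥ N` (p3's suggestion): for `d ≡ 3 (mod 4)`, `f₂(W ⊗ d) = 4 ↔ f₂(W) ≤ 3` and `f₂(W) = 4 ↔ f₂(W ⊗ d) ≤ 3`
  (S-an-63L one way, this seat's g13 `conductorExponent_quadraticTwist_eq_four_of_le_three_of_emod_four_eq_three` the other, and the involution
  `(W ⊗ d) ⊗ d ≅ W`).
HONEST FRAMING: an E-blind local bookkeeping law in print, now a tree theorem; it says that no `χ₋₄`-orbit is stable inside `16 ∥ N`.  Nothing about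
BSD or Manin's conjecture is proved; C2 OPEN. [cite: BarriosEtAl2025, Thm. 5.1 (arXiv:2501.03209 pp. 15–16), Table localdata-dodd, all rows with f = 4]
[cite: SilvermanATAEC1994, IV.9.4 and IV.11.1] [cite: SilvermanAEC2009, C.16]
-/

set_option autoImplicit false
-- lint-debt: the directory name repeats the summit name (sibling precedent `ManinLocalTwoThreeQuadraticTwistAtTwoConductorBarriosRows.lean`)
set_option linter.dupNamespace false

noncomputable section

open scoped Classical
open WeierstrassCurve IsDedekindDomain IsDedekindDomain.HeightOneSpectrum Rat.HeightOneSpectrum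
  Literature.NumberTheory.DiophantineGeometry Literature.NumberTheory.EllipticCurves

namespace Summit.BirchSwinnertonDyer.BirchSwinnertonDyer.Theorems.ManinLocalTwoThree

/-! ## §1 Every `d ≡ 3 (mod 4)`: an's S-an-63L body -/

/-- **S-an-63L (an g32 §11 `conductorExponent_quadraticTwist_two_of_eq_four`), PROVED — «16 ∥ N descends»**: for `W/ℚ` elliptic, `v` the place of `ℤ`
above `2` with `f_v(W) = 4`, and `d ≡ 3 (mod 4)`, `f_v(W ⊗ d) ≤ 3`.  The def body is an's VERBATIM, so the node, once typed, is discharged by this term.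
[cite: BarriosEtAl2025, Thm. 5.1 (arXiv:2501.03209 pp. 15–16), Table localdata-dodd, all rows with f = 4, d ≡ 3 (mod 4)] -/
theorem conductorExponent_quadraticTwist_le_three_of_eq_four_of_emod_four_eq_three :
    ∀ (W : WeierstrassCurve ℚ) [W.IsElliptic] (v : IsDedekindDomain.HeightOneSpectrum ℤ),
      Rat.HeightOneSpectrum.natGenerator v = 2 → W.conductorExponent v = 4 → ∀ d : ℤ,
        d % 4 = 3 → (W.quadraticTwist (d : ℚ)).conductorExponent v ≤ 3 := by
  intro W _ v hv hf d hd
  refine conductorExponent_quadraticTwist_of_emod_four_eq_three_two W v hv hd (fun n ↦ n ≤ 3) ?_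
  intro V _ hV
  exact conductorExponent_quadraticTwist_negOne_le_three_of_eq_four' V v hv (hV.trans hf)

/-- **No `f₂ = 4` class is `χ_d`-stable for `d ≡ 3 (mod 4)`**: `f₂(W) = 4 ⟹ f₂(W ⊗ d) ≠ 4`. [cite: BarriosEtAl2025, Thm. 5.1, Table localdata-dodd] -/
theorem conductorExponent_quadraticTwist_ne_four_of_eq_four_of_emod_four_eq_three (W : WeierstrassCurve ℚ) [W.IsElliptic]
    (v : HeightOneSpectrum ℤ) (hv : natGenerator v = 2) (hf : W.conductorExponent v = 4) {d : ℤ} (hd : d % 4 = 3) :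
    (W.quadraticTwist (d : ℚ)).conductorExponent v ≠ 4 := by
  have := conductorExponent_quadraticTwist_le_three_of_eq_four_of_emod_four_eq_three W v hv hf d hd
  omega

/-! ## §2 The conductor-norm form: an's S-an-63 `SixteenExactDescends` body -/

/-- **S-an-63 `SixteenExactDescends` (an g32 §11), PROVED**: `16 ∥ N(W) ⟹ 16 ∤ N(W ⊗ χ₋₄)` — the def body VERBATIM
(`2 ^ 4 ∣ N(W) → ¬ 2 ^ 5 ∣ N(W) → ¬ 2 ^ 4 ∣ N(W ⊗ (−1))`): `(N(W)).factorization 2 = f₂(W)` (`factorization_conductorNorm`), so `16 ∥ N(W)` is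
`f₂(W) = 4`, and then `f₂(W ⊗ (−1)) ≤ 3`. [cite: BarriosEtAl2025, Thm. 5.1 (arXiv:2501.03209 pp. 15–16), Table localdata-dodd, all rows with f = 4]
[cite: SilvermanAEC2009, C.16] -/
theorem sixteenExactDescends :
    ∀ (W : WeierstrassCurve ℚ) [W.IsElliptic],
      2 ^ 4 ∣ W.conductorNorm ℤ → ¬ 2 ^ 5 ∣ W.conductorNorm ℤ →
      ¬ 2 ^ 4 ∣ (haveI := W.isElliptic_quadraticTwist (show ((-1 : ℤ) : ℚ) ≠ 0 by norm_num);
        (W.quadraticTwist ((-1 : ℤ) : ℚ)).conductorNorm ℤ) := by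
  intro W _ h16 h32 h16'
  haveI : Fact (Nat.Prime 2) := ⟨Nat.prime_two⟩
  have hd0 : ((-1 : ℤ) : ℚ) ≠ 0 := by norm_num
  haveI := W.isElliptic_quadraticTwist hd0
  set v : HeightOneSpectrum ℤ := (primesEquiv (R := ℤ)).symm ⟨2, Nat.prime_two⟩ with hvdef
  have hv : natGenerator v = 2 := congrArg Subtype.val ((primesEquiv (R := ℤ)).apply_symm_apply ⟨2, Nat.prime_two⟩)
  have hfacW : (W.conductorNorm ℤ).factorization 2 = W.conductorExponent v := by
    rw [← hv]; exact W.factorization_conductorNorm_holds v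
  have hfacT : ((W.quadraticTwist ((-1 : ℤ) : ℚ)).conductorNorm ℤ).factorization 2 =
      (W.quadraticTwist ((-1 : ℤ) : ℚ)).conductorExponent v := by
    rw [← hv]; exact (W.quadraticTwist ((-1 : ℤ) : ℚ)).factorization_conductorNorm_holds v
  have hN0 : W.conductorNorm ℤ ≠ 0 := (W.conductorNorm_pos_holds).ne'
  have hN0' : (W.quadraticTwist ((-1 : ℤ) : ℚ)).conductorNorm ℤ ≠ 0 := ((W.quadraticTwist ((-1 : ℤ) : ℚ)).conductorNorm_pos_holds).ne'
  have h4le : 4 ≤ (W.conductorNorm ℤ).factorization 2 := (Nat.prime_two.pow_dvd_iff_le_factorization hN0).mp h16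
  have h5 : ¬ 5 ≤ (W.conductorNorm ℤ).factorization 2 := fun h ↦ h32 ((Nat.prime_two.pow_dvd_iff_le_factorization hN0).mpr h)
  have hf : W.conductorExponent v = 4 := by rw [← hfacW]; omega
  have h4le' : 4 ≤ ((W.quadraticTwist ((-1 : ℤ) : ℚ)).conductorNorm ℤ).factorization 2 :=
    (Nat.prime_two.pow_dvd_iff_le_factorization hN0').mp h16'
  have hle := conductorExponent_quadraticTwist_negOne_le_three_of_eq_four' W v hv hf
  rw [← hfacT] at hle
  omega

/-- **`v₂` form**: `v₂(N(W)) = 4 ⟹ v₂(N(W ⊗ (−1))) ≤ 3`. [cite: BarriosEtAl2025, Thm. 5.1, Table localdata-dodd] [cite: SilvermanAEC2009, C.16] -/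
theorem padicValNat_two_conductorNorm_quadraticTwist_negOne_le_three_of_eq_four (W : WeierstrassCurve ℚ) [W.IsElliptic]
    (hN : padicValNat 2 (W.conductorNorm ℤ) = 4) :
    padicValNat 2 ((W.quadraticTwist ((-1 : ℤ) : ℚ)).conductorNorm ℤ) ≤ 3 := by
  haveI : Fact (Nat.Prime 2) := ⟨Nat.prime_two⟩
  have hd0 : ((-1 : ℤ) : ℚ) ≠ 0 := by norm_num
  haveI := W.isElliptic_quadraticTwist hd0
  set v : HeightOneSpectrum ℤ := (primesEquiv (R := ℤ)).symm ⟨2, Nat.prime_two⟩ with hvdef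
  have hv : natGenerator v = 2 := congrArg Subtype.val ((primesEquiv (R := ℤ)).apply_symm_apply ⟨2, Nat.prime_two⟩)
  have hfacW : (W.conductorNorm ℤ).factorization 2 = W.conductorExponent v := by
    rw [← hv]; exact W.factorization_conductorNorm_holds v
  have hfacT : ((W.quadraticTwist ((-1 : ℤ) : ℚ)).conductorNorm ℤ).factorization 2 =
      (W.quadraticTwist ((-1 : ℤ) : ℚ)).conductorExponent v := by
    rw [← hv]; exact (W.quadraticTwist ((-1 : ℤ) : ℚ)).factorization_conductorNorm_holds v
  rw [← Nat.factorization_def _ Nat.prime_two] at hN ⊢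
  rw [hfacT]
  exact conductorExponent_quadraticTwist_negOne_le_three_of_eq_four' W v hv (by rw [← hfacW]; exact hN)

/-! ## §3 The `χ_d`-orbit law at `16 ∥ N` -/

/-- **`f_v((W ⊗ d) ⊗ d) = f_v(W)`**: `(W ⊗ d) ⊗ d = W ⊗ d² ≅ W ⊗ 1 ≅ W` over `ℚ`, and `f_v` is an isomorphism invariant.
[cite: SilvermanAEC2009, X.5 Cor. 5.4] -/
theorem conductorExponent_quadraticTwist_quadraticTwist_self (W : WeierstrassCurve ℚ) [W.IsElliptic] (v : HeightOneSpectrum ℤ)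
    {d : ℚ} (hd : d ≠ 0) :
    ((W.quadraticTwist d).quadraticTwist d).conductorExponent v = W.conductorExponent v := by
  haveI := W.isElliptic_quadraticTwist hd
  haveI := (W.quadraticTwist d).isElliptic_quadraticTwist hd
  haveI := W.isElliptic_quadraticTwist (one_ne_zero (α := ℚ))
  obtain ⟨C₂, hC₂⟩ := W.exists_variableChange_quadraticTwist_mul_sq 1 d hd
  obtain ⟨C₃, hC₃⟩ := W.exists_variableChange_quadraticTwist_one
  have h : (W.quadraticTwist d).quadraticTwist d = (C₂ * C₃) • W := by
    rw [mul_smul, hC₃, hC₂, WeierstrassCurve.quadraticTwist_quadraticTwist]; congr 1; ring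
  rw [h, conductorExponent_smul']

/-- **The `χ_d`-orbit law, first form** (`d ≡ 3 (mod 4)`, `v` the place of `ℤ` above `2`): `f_v(W ⊗ d) = 4 ↔ f_v(W) ≤ 3` — a class with `16 ∥ N`
is the `χ_d`-twist of exactly the classes with `v₂(N) ≤ 3` (Barrios et al. 2025, Thm. 5.1: the `f ≤ 3` rows all have `f^d = 4`, no `f = 4` row has
`f^d = 4`). [cite: BarriosEtAl2025, Thm. 5.1 (arXiv:2501.03209 pp. 15–16), Table localdata-dodd, d ≡ 3 (mod 4)] -/
theorem conductorExponent_quadraticTwist_eq_four_iff_le_three_of_emod_four_eq_three (W : WeierstrassCurve ℚ) [W.IsElliptic]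
    (v : HeightOneSpectrum ℤ) (hv : natGenerator v = 2) {d : ℤ} (hd : d % 4 = 3) :
    (W.quadraticTwist (d : ℚ)).conductorExponent v = 4 ↔ W.conductorExponent v ≤ 3 := by
  have hd0 : (d : ℚ) ≠ 0 := by exact_mod_cast (show d ≠ 0 by omega)
  haveI := W.isElliptic_quadraticTwist hd0
  refine ⟨fun h ↦ ?_, fun h ↦ conductorExponent_quadraticTwist_eq_four_of_le_three_of_emod_four_eq_three W v hv h hd⟩
  have := conductorExponent_quadraticTwist_le_three_of_eq_four_of_emod_four_eq_three (W.quadraticTwist (d : ℚ)) v hv h d hd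
  rwa [conductorExponent_quadraticTwist_quadraticTwist_self W v hd0] at this

/-- **The `χ_d`-orbit law, second form** (`d ≡ 3 (mod 4)`): `f_v(W) = 4 ↔ f_v(W ⊗ d) ≤ 3` — «16 ∥ N descends», and only `16 ∥ N` descends to
`v₂(N) ≤ 3`. [cite: BarriosEtAl2025, Thm. 5.1 (arXiv:2501.03209 pp. 15–16), Table localdata-dodd, d ≡ 3 (mod 4)] -/
theorem conductorExponent_eq_four_iff_quadraticTwist_le_three_of_emod_four_eq_three (W : WeierstrassCurve ℚ) [W.IsElliptic]
    (v : HeightOneSpectrum ℤ) (hv : natGenerator v = 2) {d : ℤ} (hd : d % 4 = 3) :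
    W.conductorExponent v = 4 ↔ (W.quadraticTwist (d : ℚ)).conductorExponent v ≤ 3 := by
  have hd0 : (d : ℚ) ≠ 0 := by exact_mod_cast (show d ≠ 0 by omega)
  haveI := W.isElliptic_quadraticTwist hd0
  refine ⟨fun h ↦ conductorExponent_quadraticTwist_le_three_of_eq_four_of_emod_four_eq_three W v hv h d hd, fun h ↦ ?_⟩
  have := conductorExponent_quadraticTwist_eq_four_of_le_three_of_emod_four_eq_three (W.quadraticTwist (d : ℚ)) v hv h hd
  rwa [conductorExponent_quadraticTwist_quadraticTwist_self W v hd0] at this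

end Summit.BirchSwinnertonDyer.BirchSwinnertonDyer.Theorems.ManinLocalTwoThree

end
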